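import Summits.QuantumFields.YangMills.Theorems.BalabanUVNodesN21HistoriesLiftedStageLaws

/-!
# N21 (NE7c) — module 38c «THE 20n JUNCTION OVER LIFTED DENSITIES»: 20n `shellWeightBound_histories_of_resamplingTower` BY NAME with the stage laws
# CONSTRUCTED on one product history space per cutoff from truncated term densities, forward kernels and the HYBRID RESAMPLING LIFT (38a, lens
# Card 56; 38b) — the four stage-law binders per run (N) `hN`, (Eoff) `hoff`, (Mass) `hmass` (Fubini identities) and (Eon) `hon` (printed
# quotient bound + charge) DISCHARGED

Seat `pub-ymgap-dag-n21-e` (g12), own hand — g8's trigger t23 «the 20n junction» made a theorem at the level of lens Card 56's dictionary (the record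
INSTANCE on the v1.7 `CoPH` tower and the number `q̄` stay ahead); lane `--kind proof --supports stmt-QuantumFields-20544 --as helper` (K3⁷
`SpineGivenEndpointR13SepCoPH`).  Count-neutral.

THE THEOREM ([folklore]).  `shellWeightBound_histories_of_liftedDensities`: per cutoff `K` ONE product history space `Π i : 𝔅 K, X K i` (product
probability reference law); per run, stage `k`, term `s` a truncated density `d K a k s` and a forward kernel `Φ K a k` over the younger coordinates
`Y K k`; older coordinates `O K k`, fibres `F K k s`, and per sent term an INSERT `ins K a k s` (lens v21.0 ROW P′: a parameter — the
(0.3)-literal receiver law `d (sel s)` of record, or print's background-centred WINDOW law (1.100)–(1.101)); stage laws `JpreX := preLaw`,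
`JX := postLaw` of 38b.  20n's END is applied BY NAME with these laws;
its stage-law binders become: (N) `hN` ⟸ an older statistic reads no younger fibre and no younger coordinate (`hpast`, `hyng`; 38b
`map_postLaw_eq_of_notRead`); (Eoff) `hoff` ⟸ OFF := the receiver statistic does not read the sender's fibre (`hoffR`); (Mass) `hmass` ⟸ 38b
`postLaw_univ_eq` per term; (Eon) `hon` ⟸ the printed quotient bound AGAINST THE INSERT `hquot` (lens Card 58's environment-uniform single-∕multi-component bound;
HONEST: a finite exterior-uniform `q` is print's for the WINDOW insert, [LF-II] p. 358 «bounded from below by exp(−O(M⁴))»; for the receiver-law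
insert on sharp-threshold terms NO finite `q` exists — lens v21.0 Card 61, Sketch-g21 §T `toy_quotient_unbounded`), the NESTING `hdom : ins s ≤ B·d (sel s)`
((1.89) p. 198 ∕ (1.70) [LF-II]; `B` may be large), with CHARGE `hcharge : Σ_{s ON, sel s = s′} q·B ≤ δr` (lens Card 57; 38b
`charge_le_of_components` gives `(1+q̄)^{ν̄} − 1` from a component count; bounded uniformly in `K` suffices, ROW Q″), ON terms sent (`hOnSent`),
receivers `sel`-fixed (`hfix`).  DISPLAYED AND UNTOUCHED (20n's other
binders, now about the constructed laws): (P) `hP` (decomposition of unity × kernel; §0 `sum_preLaw_eq_postLaw` reduces it to a pointwise density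
identity, §0 here), older-causality `hdepTot` (§0 `sum_preLaw_congr`; lens N122: constructional on the record), (Tilt) `htilt`, absorption `habs`,
N16-determinism `hdet`, window geometry `hgeom`∕`hwin`, numerics; the history-space data `Disjoint O F`, `Disjoint Y O`, `Disjoint Y F`, `IndepOf Y d`,
`∫⋯∫⁻_Y Φ = 1`, finiteness `∫ d·Φ < ∞`, and the denominators' SUPPORT proviso `hden` (for a sent term: wherever the receiver's fibre integral
`∫⋯∫⁻_F ρ` vanishes so does the sender's, and it is finite — weaker than b01's `≠ 0`, which fails at indicator-carrying receivers of record, lens KT-56b;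
38b `lmarginal_fibre_hybridLift_of_support`).  Conclusion and constant
= 20n's verbatim (`M₁∕M₂ = e^{2l₀B}(1+δr)`).  §4 = the A6 SATISFIABILITY WITNESS (director-ym STANDING A6 RULE №189 (3)): the theorem APPLIED to one-point
toy data with every binder discharged in the kernel (`liftedDensities_binders_inhabited`) — the binder set is jointly consistent.

HONEST FRAMING.  [folklore] bookkeeping; 0 def, 0 sorry; NOTHING of Bałaban's is asserted (context only: [Balaban1989LargeFieldI] (0.3)–(0.4) p. 176,
«the quotients are still small» L18–26); `q`∕`δr` DISPLAYED — NODE O's environment-uniform quotient bound at live levels is the ONE analytic input of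
road I (lens v20.0 §0 (5)); the INSTANCE on the record's v1.7 `CoPH` tower (densities `χ·TexpA` truncated per level, forward kernels = the RG
kernels, fibres = def-R's `fibOfSeq`, `NotRead` = 31∕33's read-set geometry, (N)∕(Eoff) at one level = 37 §3) is NOT built here; NE7c ((M1) at the
live slots) is NOT PRINTED and NOT PROVED; N21 NOT discharged; count-neutral; one finite 𝕋⁴ at fixed ε — nothing about ℝ⁴ ∕ OS ∕ mass gap ∕ Clay.

CITATION HEADER (lean-in-tree rule).  BY NAME: 20n `N21HistoriesResamplingTower.shellWeightBound_histories_of_resamplingTower`; 38b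
`N21HistoriesLiftedStageLaws.preLaw` ∕ `postLaw` ∕ `liftDensity` ∕ `postLaw_univ_eq` ∕ `map_postLaw_eq_of_notRead` ∕ `sum_map_postLaw_le` ∕
`pi_withDensity_univ`; 38a `N21HybridResamplingLift.NotRead`; b01 `B15.BasicStep.IndepOf`; leaf `ShellMeasureRootCompositionHistories.histWeight` ∕
`histShell`; `T4IndicatorShell.ShellWeightBound`; `T4ShellMeasureLevels.LiveWindow`; 20k `N21HistoriesAbsorbingDefs.Absorbing`.
-/

set_option autoImplicit false

open MeasureTheory Set Function
open scoped BigOperators ENNReal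
open Literature.MathematicalPhysics.QuantumFieldTheory.Balaban1983to89.B15.BasicStep

namespace Summit.QuantumFields.YangMills.Theorems.N21HistoriesHybridLiftTower

open Summit.QuantumFields.YangMills.Theorems.N21HybridResamplingLift (NotRead senderCharge_le_pow)
open Summit.QuantumFields.YangMills.Theorems.N21HistoriesLiftedStageLaws

/-! ## §0 The displayed binders (P) and older-causality at DENSITY level, and the charge from a component count (lens Card 57) -/

section DensityLevel

variable {β : Type*} [Fintype β] [DecidableEq β] {X : β → Type*} [∀ i, MeasurableSpace (X i)]
  {μ : ∀ i, Measure (X i)} [∀ i, IsProbabilityMeasure (μ i)] {ι : Type*} [DecidableEq ι]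
  {O Y : Finset β} {F : ι → Finset β} {sel : ι → ι} {Φ : (∀ i, X i) → ℝ≥0∞} {ins d : ι → (∀ i, X i) → ℝ≥0∞}

omit [∀ i, IsProbabilityMeasure (μ i)] in
/-- **(P) FROM A DENSITY IDENTITY**: if the next stage's truncated densities of the terms `e ∈ E` (the pre-images of `s`) times the next
forward kernel sum POINTWISE to `s`'s lifted density times the current kernel — decomposition of unity × conditional kernel — then the
pre-ℝ stage laws of `E` sum to the post-ℝ stage law of `s` (20n's `hP` for the constructed laws). [folklore] -/
theorem sum_preLaw_eq_postLaw {Φ' : (∀ i, X i) → ℝ≥0∞} {d' : ι → (∀ i, X i) → ℝ≥0∞} (hd' : ∀ e, Measurable (d' e))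
    (hΦ' : Measurable Φ') (E : Finset ι) (s : ι)
    (hunity : ∀ V, ∑ e ∈ E, d' e V * Φ' V = liftDensity μ O F sel ins d s V * Φ V) :
    ∑ e ∈ E, preLaw μ Φ' d' e = postLaw μ O F sel Φ ins d s := by
  simp only [preLaw, postLaw]
  rw [← N21HistoriesModelADefs.withDensity_finsetSum' E (Measure.pi μ) (fun e V => d' e V * Φ' V) fun e => (hd' e).mul hΦ']
  exact withDensity_congr_ae (Filter.Eventually.of_forall hunity)

omit [DecidableEq β] [∀ i, IsProbabilityMeasure (μ i)] [DecidableEq ι] in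
/-- **OLDER-CAUSALITY FROM A DENSITY IDENTITY**: two pre-ℝ stage totals with pointwise equal total densities agree (20n's `hdepTot` for
the constructed laws, once the birth-stage total density is shown to read the older thresholds only). [folklore] -/
theorem sum_preLaw_congr {Φ₁ Φ₂ : (∀ i, X i) → ℝ≥0∞} {d₁ d₂ : ι → (∀ i, X i) → ℝ≥0∞} (hd₁ : ∀ e, Measurable (d₁ e))
    (hd₂ : ∀ e, Measurable (d₂ e)) (hΦ₁ : Measurable Φ₁) (hΦ₂ : Measurable Φ₂) (E : Finset ι)
    (h : ∀ V, ∑ e ∈ E, d₁ e V * Φ₁ V = ∑ e ∈ E, d₂ e V * Φ₂ V) :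
    ∑ e ∈ E, preLaw μ Φ₁ d₁ e = ∑ e ∈ E, preLaw μ Φ₂ d₂ e := by
  simp only [preLaw]
  rw [← N21HistoriesModelADefs.withDensity_finsetSum' E (Measure.pi μ) (fun e V => d₁ e V * Φ₁ V) fun e => (hd₁ e).mul hΦ₁,
    ← N21HistoriesModelADefs.withDensity_finsetSum' E (Measure.pi μ) (fun e V => d₂ e V * Φ₂ V) fun e => (hd₂ e).mul hΦ₂]
  exact withDensity_congr_ae (Filter.Eventually.of_forall h)

omit [Fintype β] [DecidableEq β] [∀ i, MeasurableSpace (X i)] [∀ i, IsProbabilityMeasure (μ i)] [DecidableEq ι] in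
/-- **THE CHARGE FROM A COMPONENT COUNT** (lens Card 57 made pluggable into `hcharge`): if the ON senders into one receiver are labelled
INJECTIVELY by non-empty sub-families `comp s` of a set `U` of at most `n` erasable components, each sender's printed quotient being at
most the product of single-component bounds `qc i ∈ [0, q̄]` over its family (lens Card 58's telescoping), then their charge is
`≤ (1+q̄)^n − 1` — K-uniform by counting alone. [folklore] -/
theorem charge_le_of_components {Cp : Type*} [DecidableEq Cp] (A : Finset ι) (U : Finset Cp) (comp : ι → Finset Cp)
    (hinj : Set.InjOn comp A) (hsub : ∀ s ∈ A, comp s ∈ U.powerset.erase ∅)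
    {qr : ι → ℝ} {qc : Cp → ℝ} {qbar : ℝ} {n : ℕ} (hqr0 : ∀ s ∈ A, 0 ≤ qr s)
    (hqr : ∀ s ∈ A, qr s ≤ ∏ i ∈ comp s, qc i) (hqc0 : ∀ i ∈ U, 0 ≤ qc i) (hqc : ∀ i ∈ U, qc i ≤ qbar)
    (hn : U.card ≤ n) (hqbar : 0 ≤ qbar) :
    ∑ s ∈ A, ENNReal.ofReal (qr s) ≤ ENNReal.ofReal ((1 + qbar) ^ n - 1) := by
  rw [← ENNReal.ofReal_sum_of_nonneg hqr0]
  refine ENNReal.ofReal_le_ofReal ?_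
  have hprod0 : ∀ S ∈ U.powerset.erase ∅, 0 ≤ ∏ i ∈ S, qc i := fun S hS =>
    Finset.prod_nonneg fun i hi => hqc0 i (Finset.mem_powerset.1 (Finset.mem_of_mem_erase hS) hi)
  calc ∑ s ∈ A, qr s ≤ ∑ s ∈ A, ∏ i ∈ comp s, qc i := Finset.sum_le_sum hqr
    _ = ∑ S ∈ A.image comp, ∏ i ∈ S, qc i := (Finset.sum_image (f := fun S => ∏ i ∈ S, qc i) hinj).symm
    _ ≤ ∑ S ∈ U.powerset.erase ∅, ∏ i ∈ S, qc i :=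
        Finset.sum_le_sum_of_subset_of_nonneg (Finset.image_subset_iff.2 hsub) fun S hS _ => hprod0 S hS
    _ ≤ (1 + qbar) ^ n - 1 := senderCharge_le_pow U hqc0 hqc hn hqbar

end DensityLevel

/-! ## §3 THE JUNCTION: 20n's resampling tower BY NAME, its stage laws CONSTRUCTED from densities, forward kernels and the hybrid lift on
ONE product history space per cutoff `K`; the stage-law binders (N) `hN`, (Eoff) `hoff`, (Eon) `hon`, (Mass) `hmass` of BOTH runs DISCHARGED -/

section Junction

open Literature.MathematicalPhysics.QuantumFieldTheory.Balaban1983to89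
open T4IndicatorShell (ShellWeightBound)
open T4ShellMeasureLevels (LiveWindow)
open Summit.QuantumFields.BalabanUV.T4Continuum.ShellMeasureRootCompositionHistories (histWeight histShell partialLaw)
open Summit.QuantumFields.YangMills.Theorems.N21HistoriesAbsorbingDefs (Absorbing)
open Summit.QuantumFields.YangMills.Theorems.N21HistoriesResamplingTower (shellWeightBound_histories_of_resamplingTower)

variable {𝔅 : ℕ → Type*} [∀ K, Fintype (𝔅 K)] [∀ K, DecidableEq (𝔅 K)] {X : (K : ℕ) → 𝔅 K → Type*}
  [∀ K i, MeasurableSpace (X K i)] {μ : (K : ℕ) → (i : 𝔅 K) → Measure (X K i)} [∀ K i, IsProbabilityMeasure (μ K i)]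
  {σ ι : Type*} [DecidableEq σ] [DecidableEq ι]
  {T : ℕ → Finset ι} {C : ℕ → Finset σ} {small smAll : ℕ → ι → Finset σ} {nbhd : ℕ → ι → σ → Finset σ} {lvl : ℕ → σ → ℕ}
  {I : ℕ → ℕ → Finset ι} {pre sel : ℕ → ℕ → ι → ι} {On : ℕ → ℕ → σ → Finset ι}
  {O Y : (K : ℕ) → ℕ → Finset (𝔅 K)} {F : (K : ℕ) → ℕ → ι → Finset (𝔅 K)}
  {ΦA ΦB : (K : ℕ) → (ℕ → ℝ) → ℕ → (∀ i, X K i) → ℝ≥0∞}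
  {dA dB insA insB : (K : ℕ) → (ℕ → ℝ) → ℕ → ι → (∀ i, X K i) → ℝ≥0∞}
  {qA qB BA BB : (K : ℕ) → (ℕ → ℝ) → ℕ → ι → ℝ≥0∞}
  {νA νB : ∀ K : ℕ, (ℕ → ℝ) → ℝ → ι → Measure (∀ i, X K i)}
  [∀ K a t τ, IsFiniteMeasure (νA K a t τ)] [∀ K a t τ, IsFiniteMeasure (νB K a t τ)]
  {uA uB : ∀ K : ℕ, σ → (∀ i, X K i) → ℝ} {θ κ ρ Δ : ℕ → ℝ} {l₀ νbar δr B : ℝ}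

/-- **N21's ROAD I ON HISTORY FAMILIES FROM LIFTED DENSITIES (end-to-end; 20n BY NAME).**  Per cutoff `K` ONE product history space
`Π i : 𝔅 K, X K i` with product probability reference law; per run, stage `k` and term `s` a TRUNCATED term density `d K a k s` and a forward
kernel `Φ K a k` (fibrewise mass one over the younger coordinates `Y K k`, not read by the densities nor by the statistics of levels `≤ k`), and
per sent term an insert `ins K a k s`; the pre-ℝ stage law is `preLaw = pi.withDensity (d s · Φ)` and the post-ℝ stage law `postLaw =
pi.withDensity (liftDensity s · Φ)` with the SENT terms (`sel s ≠ s`) hybrid-lifted against their inserts over the older coordinates `O K k` and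
their fibres `F K k s` (38a, lens Card 56; 38b, ROW P′).  Then 20n's four
stage-law binders per run are THEOREMS: (N) `hN` — an older statistic reads no younger fibre (`hpast`); (Eoff) `hoff` — OFF := the receiver
statistic does not read the sender's fibre (`hoffR`); (Mass) `hmass` — per term; (Eon) `hon` — the printed quotient bound `q` against the insert (`hquot`,
lens Card 58's shape; finite for print's WINDOW insert, [LF-II] p. 358 — NOT for the receiver-law insert on sharp-threshold terms, lens Card 61),
the nesting `ins ≤ B·receiver` (`hdom`) and the charge `Σ_{ON → s′} q·B ≤ δr` (`hcharge`, lens Card 57), receivers being `sel`-fixed stage terms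
(`hfix`) and ON terms sent (`hOnSent`).  Displayed and untouched: the inserts' denominator SUPPORT provisos `hden` (38b; weaker than b01's `≠ 0`), 20n's (P) `hP`, older-causality
`hdepTot`, (Tilt) `htilt`, absorption, N16-determinism, the window geometry and numerics.  Conclusion = 20n's, constant
`2((N₁+1)ν̄(e^{l₀B}(1+δr)∕e^{−l₀B}·4ν̄∕κ_min)c₁ϑ^{−N₁})ϑ^K`. [folklore] -/
theorem shellWeightBound_histories_of_liftedDensities {N₁ : ℕ} {κmin c₁ ϑ : ℝ}
    (huA : ∀ K s, Measurable (uA K s)) (huB : ∀ K s, Measurable (uB K s))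
    (hsmall : ∀ K, ∀ τ ∈ T K, small K τ ⊆ C K) (hsub : ∀ K, ∀ τ ∈ T K, small K τ ⊆ smAll K τ)
    (hθ : ∀ j, 0 < θ j) (hκ : ∀ j, 0 < κ j ∧ κ j ≤ 1) (hρ : ∀ j, 0 ≤ ρ j ∧ ρ j < 1)
    (hwin : LiveWindow C lvl N₁ νbar) (hδ : 0 ≤ δr)
    (hΔ : ∀ j, Δ j ≤ ρ j * ((1 - κ j) * θ j))
    (hgeom : ∀ K, ∀ τ ∈ T K, ∀ s ∈ small K τ, nbhd K τ s ⊆ smAll K τ)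
    (hdetA : ∀ K, ∀ τ ∈ T K, ∀ s ∈ small K τ, ∀ ω, (∀ c ∈ nbhd K τ s, uA K c ω < θ (lvl K c)) → |uA K s ω - uB K s ω| ≤ Δ (lvl K s))
    (hdetB : ∀ K, ∀ τ ∈ T K, ∀ s ∈ small K τ, ∀ ω, (∀ c ∈ nbhd K τ s, uB K c ω < θ (lvl K c)) → |uB K s ω - uA K s ω| ≤ Δ (lvl K s))
    (habsA : ∀ (K : ℕ) (a : ℕ → ℝ), (∀ j, a j ∈ Icc ((1 - κ j) * θ j) (θ j)) → ∀ t, |t| ≤ l₀ → ∀ τ ∈ T K,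
      Absorbing (νA K a t τ) (smAll K τ) (uA K) (fun c => a (lvl K c)))
    (habsB : ∀ (K : ℕ) (a : ℕ → ℝ), (∀ j, a j ∈ Icc ((1 - κ j) * θ j) (θ j)) → ∀ t, |t| ≤ l₀ → ∀ τ ∈ T K,
      Absorbing (νB K a t τ) (smAll K τ) (uB K) (fun c => a (lvl K c)))
    -- the tower: combinatorics shared by the two runs
    (hpre : ∀ K k, k < K → ∀ e ∈ I K (k + 1), pre K k e ∈ I K k) (hIT : ∀ K, I K K = T K)
    (hsel : ∀ K k, ∀ s ∈ I K k, sel K k s ∈ I K k)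
    (hfix : ∀ K k, ∀ s ∈ I K k, sel K k (sel K k s) = sel K k s)
    (hOnSent : ∀ K k c, ∀ s ∈ On K k c, sel K k s ≠ s)
    -- the history space: older coordinates, fibres, younger coordinates
    (hOF : ∀ K k s, Disjoint (O K k) (F K k s)) (hYO : ∀ K k, Disjoint (Y K k) (O K k)) (hYF : ∀ K k s, Disjoint (Y K k) (F K k s))
    -- run A: densities, forward kernels, quotients
    (hdAm : ∀ K a k s, Measurable (dA K a k s)) (hinsAm : ∀ K a k s, Measurable (insA K a k s))
    (hΦAm : ∀ K a k, Measurable (ΦA K a k))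
    (hdAY : ∀ K a k s, IndepOf (Y K k) (dA K a k s)) (hinsAY : ∀ K a k s, IndepOf (Y K k) (insA K a k s))
    (hΦA1 : ∀ K a k, ∫⋯∫⁻_(Y K k), ΦA K a k ∂μ K = fun _ => 1)
    (hfinA : ∀ K a k s, ∫⁻ V, dA K a k s V * ΦA K a k V ∂Measure.pi (μ K) ≠ ∞)
    (hdenA : ∀ K a k s, sel K k s ≠ s → ∀ V,
      ((∫⋯∫⁻_(F K k s), (∫⋯∫⁻_(O K k), insA K a k s ∂μ K) ∂μ K) V = 0 →
          (∫⋯∫⁻_(F K k s), dA K a k s ∂μ K) V = 0) ∧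
        (∫⋯∫⁻_(F K k s), (∫⋯∫⁻_(O K k), insA K a k s ∂μ K) ∂μ K) V ≠ ∞)
    (hpastA : ∀ K, ∀ c ∈ C K, ∀ k, lvl K c < k → ∀ s ∈ I K k, sel K k s ≠ s → NotRead (F K k s) (uA K c))
    (hoffRA : ∀ K, ∀ c ∈ C K, ∀ s ∈ I K (lvl K c), sel K (lvl K c) s ≠ s → s ∉ On K (lvl K c) c →
      NotRead (F K (lvl K c) s) (uA K c))
    (hcurA : ∀ K, ∀ c ∈ C K, NotRead (O K (lvl K c)) (uA K c))
    (hyngA : ∀ K, ∀ c ∈ C K, ∀ k, lvl K c ≤ k → NotRead (Y K k) (uA K c))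
    (hquotA : ∀ (K : ℕ) (a : ℕ → ℝ), (∀ j, a j ∈ Icc ((1 - κ j) * θ j) (θ j)) → ∀ c ∈ C K, ∀ s ∈ I K (lvl K c),
      s ∈ On K (lvl K c) c → ∀ V, (∫⋯∫⁻_(O K (lvl K c) ∪ F K (lvl K c) s), dA K a (lvl K c) s ∂μ K) V ≤
        qA K a (lvl K c) s * (∫⋯∫⁻_(O K (lvl K c) ∪ F K (lvl K c) s), insA K a (lvl K c) s ∂μ K) V)
    (hdomA : ∀ (K : ℕ) (a : ℕ → ℝ), (∀ j, a j ∈ Icc ((1 - κ j) * θ j) (θ j)) → ∀ c ∈ C K, ∀ s ∈ I K (lvl K c),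
      s ∈ On K (lvl K c) c → ∀ V, insA K a (lvl K c) s V ≤ BA K a (lvl K c) s * dA K a (lvl K c) (sel K (lvl K c) s) V)
    (hchargeA : ∀ (K : ℕ) (a : ℕ → ℝ), (∀ j, a j ∈ Icc ((1 - κ j) * θ j) (θ j)) → ∀ c ∈ C K, ∀ s' ∈ I K (lvl K c),
      ∑ s ∈ (I K (lvl K c)).filter (fun s => s ∈ On K (lvl K c) c ∧ sel K (lvl K c) s = s'),
        qA K a (lvl K c) s * BA K a (lvl K c) s ≤ ENNReal.ofReal δr)
    (hPA : ∀ (K : ℕ) (a : ℕ → ℝ), (∀ j, a j ∈ Icc ((1 - κ j) * θ j) (θ j)) → ∀ k, k < K → ∀ s ∈ I K k,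
      ∑ e ∈ (I K (k + 1)).filter (fun e => pre K k e = s), preLaw (μ K) (ΦA K a (k + 1)) (dA K a (k + 1)) e =
        postLaw (μ K) (O K k) (F K k) (sel K k) (ΦA K a k) (insA K a k) (dA K a k) s)
    (htiltA : ∀ (K : ℕ) (a : ℕ → ℝ), (∀ j, a j ∈ Icc ((1 - κ j) * θ j) (θ j)) → ∀ t, |t| ≤ l₀ → ∀ τ ∈ T K,
      νA K a t τ ≤ ENNReal.ofReal (Real.exp (l₀ * B)) • postLaw (μ K) (O K K) (F K K) (sel K K) (ΦA K a K) (insA K a K) (dA K a K) τ ∧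
        postLaw (μ K) (O K K) (F K K) (sel K K) (ΦA K a K) (insA K a K) (dA K a K) τ ≤ ENNReal.ofReal (Real.exp (l₀ * B)) • νA K a t τ)
    (hdepTotA : ∀ (K : ℕ) (s : σ) (a b : ℕ → ℝ), (∀ i, i < lvl K s → a i = b i) →
      ∑ e ∈ I K (lvl K s), preLaw (μ K) (ΦA K a (lvl K s)) (dA K a (lvl K s)) e =
        ∑ e ∈ I K (lvl K s), preLaw (μ K) (ΦA K b (lvl K s)) (dA K b (lvl K s)) e)
    -- run B: densities, forward kernels, quotients
    (hdBm : ∀ K a k s, Measurable (dB K a k s)) (hinsBm : ∀ K a k s, Measurable (insB K a k s))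
    (hΦBm : ∀ K a k, Measurable (ΦB K a k))
    (hdBY : ∀ K a k s, IndepOf (Y K k) (dB K a k s)) (hinsBY : ∀ K a k s, IndepOf (Y K k) (insB K a k s))
    (hΦB1 : ∀ K a k, ∫⋯∫⁻_(Y K k), ΦB K a k ∂μ K = fun _ => 1)
    (hfinB : ∀ K a k s, ∫⁻ V, dB K a k s V * ΦB K a k V ∂Measure.pi (μ K) ≠ ∞)
    (hdenB : ∀ K a k s, sel K k s ≠ s → ∀ V,
      ((∫⋯∫⁻_(F K k s), (∫⋯∫⁻_(O K k), insB K a k s ∂μ K) ∂μ K) V = 0 →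
          (∫⋯∫⁻_(F K k s), dB K a k s ∂μ K) V = 0) ∧
        (∫⋯∫⁻_(F K k s), (∫⋯∫⁻_(O K k), insB K a k s ∂μ K) ∂μ K) V ≠ ∞)
    (hpastB : ∀ K, ∀ c ∈ C K, ∀ k, lvl K c < k → ∀ s ∈ I K k, sel K k s ≠ s → NotRead (F K k s) (uB K c))
    (hoffRB : ∀ K, ∀ c ∈ C K, ∀ s ∈ I K (lvl K c), sel K (lvl K c) s ≠ s → s ∉ On K (lvl K c) c →
      NotRead (F K (lvl K c) s) (uB K c))
    (hcurB : ∀ K, ∀ c ∈ C K, NotRead (O K (lvl K c)) (uB K c))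
    (hyngB : ∀ K, ∀ c ∈ C K, ∀ k, lvl K c ≤ k → NotRead (Y K k) (uB K c))
    (hquotB : ∀ (K : ℕ) (a : ℕ → ℝ), (∀ j, a j ∈ Icc ((1 - κ j) * θ j) (θ j)) → ∀ c ∈ C K, ∀ s ∈ I K (lvl K c),
      s ∈ On K (lvl K c) c → ∀ V, (∫⋯∫⁻_(O K (lvl K c) ∪ F K (lvl K c) s), dB K a (lvl K c) s ∂μ K) V ≤
        qB K a (lvl K c) s * (∫⋯∫⁻_(O K (lvl K c) ∪ F K (lvl K c) s), insB K a (lvl K c) s ∂μ K) V)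
    (hdomB : ∀ (K : ℕ) (a : ℕ → ℝ), (∀ j, a j ∈ Icc ((1 - κ j) * θ j) (θ j)) → ∀ c ∈ C K, ∀ s ∈ I K (lvl K c),
      s ∈ On K (lvl K c) c → ∀ V, insB K a (lvl K c) s V ≤ BB K a (lvl K c) s * dB K a (lvl K c) (sel K (lvl K c) s) V)
    (hchargeB : ∀ (K : ℕ) (a : ℕ → ℝ), (∀ j, a j ∈ Icc ((1 - κ j) * θ j) (θ j)) → ∀ c ∈ C K, ∀ s' ∈ I K (lvl K c),
      ∑ s ∈ (I K (lvl K c)).filter (fun s => s ∈ On K (lvl K c) c ∧ sel K (lvl K c) s = s'),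
        qB K a (lvl K c) s * BB K a (lvl K c) s ≤ ENNReal.ofReal δr)
    (hPB : ∀ (K : ℕ) (a : ℕ → ℝ), (∀ j, a j ∈ Icc ((1 - κ j) * θ j) (θ j)) → ∀ k, k < K → ∀ s ∈ I K k,
      ∑ e ∈ (I K (k + 1)).filter (fun e => pre K k e = s), preLaw (μ K) (ΦB K a (k + 1)) (dB K a (k + 1)) e =
        postLaw (μ K) (O K k) (F K k) (sel K k) (ΦB K a k) (insB K a k) (dB K a k) s)
    (htiltB : ∀ (K : ℕ) (a : ℕ → ℝ), (∀ j, a j ∈ Icc ((1 - κ j) * θ j) (θ j)) → ∀ t, |t| ≤ l₀ → ∀ τ ∈ T K,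
      νB K a t τ ≤ ENNReal.ofReal (Real.exp (l₀ * B)) • postLaw (μ K) (O K K) (F K K) (sel K K) (ΦB K a K) (insB K a K) (dB K a K) τ ∧
        postLaw (μ K) (O K K) (F K K) (sel K K) (ΦB K a K) (insB K a K) (dB K a K) τ ≤ ENNReal.ofReal (Real.exp (l₀ * B)) • νB K a t τ)
    (hdepTotB : ∀ (K : ℕ) (s : σ) (a b : ℕ → ℝ), (∀ i, i < lvl K s → a i = b i) →
      ∑ e ∈ I K (lvl K s), preLaw (μ K) (ΦB K a (lvl K s)) (dB K a (lvl K s)) e =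
        ∑ e ∈ I K (lvl K s), preLaw (μ K) (ΦB K b (lvl K s)) (dB K b (lvl K s)) e)
    (hκmin : 0 < κmin) (hκminle : ∀ j, κmin ≤ κ j) (hρhalf : ∀ j, ρ j ≤ 1 / 2)
    (hϑ0 : 0 < ϑ) (hϑ1 : ϑ < 1) (hrate : ∀ j, ρ j ≤ c₁ * ϑ ^ j) :
    ∃ a : ℕ → ℕ → ℝ, (∀ K j, a K j ∈ Icc ((1 - κ j) * θ j) (θ j)) ∧
      ShellWeightBound l₀ T (fun K t τ => histWeight (νA K (a K) t τ) (small K τ) (uA K) (fun s => a K (lvl K s)))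
        (fun K t τ => histWeight (νB K (a K) t τ) (small K τ) (uB K) (fun s => a K (lvl K s)))
        (fun K t τ => histShell (νA K (a K) t τ) (small K τ) (uA K) (uB K) (fun s => a K (lvl K s)))
        (fun K t τ => histShell (νB K (a K) t τ) (small K τ) (uB K) (uA K) (fun s => a K (lvl K s)))
        fun K => (2 * ((N₁ + 1) * νbar * (Real.exp (l₀ * B) * (1 + δr) / Real.exp (-(l₀ * B)) * (2 * (2 * νbar) / κmin)) * c₁ * ϑ⁻¹ ^ N₁)) *
          ϑ ^ K := by
  -- finiteness of the constructed stage laws (instances 20n's signature wants)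
  haveI hfpreA : ∀ K a k e, IsFiniteMeasure (preLaw (μ K) (ΦA K a k) (dA K a k) e) := fun K a k e =>
    ⟨by rw [preLaw, pi_withDensity_univ]; exact (hfinA K a k e).lt_top⟩
  haveI hfpreB : ∀ K a k e, IsFiniteMeasure (preLaw (μ K) (ΦB K a k) (dB K a k) e) := fun K a k e =>
    ⟨by rw [preLaw, pi_withDensity_univ]; exact (hfinB K a k e).lt_top⟩
  have hmA : ∀ K a k e, postLaw (μ K) (O K k) (F K k) (sel K k) (ΦA K a k) (insA K a k) (dA K a k) e univ =
      preLaw (μ K) (ΦA K a k) (dA K a k) e univ := fun K a k e =>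
    postLaw_univ_eq (hinsAm K a k) (hdAm K a k) (hΦAm K a k) (hYO K k) (hYF K k) (hinsAY K a k) (hdAY K a k) (hΦA1 K a k) e
      (hdenA K a k e)
  have hmB : ∀ K a k e, postLaw (μ K) (O K k) (F K k) (sel K k) (ΦB K a k) (insB K a k) (dB K a k) e univ =
      preLaw (μ K) (ΦB K a k) (dB K a k) e univ := fun K a k e =>
    postLaw_univ_eq (hinsBm K a k) (hdBm K a k) (hΦBm K a k) (hYO K k) (hYF K k) (hinsBY K a k) (hdBY K a k) (hΦB1 K a k) e
      (hdenB K a k e)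
  haveI hfpostA : ∀ K a k e, IsFiniteMeasure (postLaw (μ K) (O K k) (F K k) (sel K k) (ΦA K a k) (insA K a k) (dA K a k) e) := fun K a k e =>
    ⟨by rw [hmA]; exact measure_lt_top _ _⟩
  haveI hfpostB : ∀ K a k e, IsFiniteMeasure (postLaw (μ K) (O K k) (F K k) (sel K k) (ΦB K a k) (insB K a k) (dB K a k) e) := fun K a k e =>
    ⟨by rw [hmB]; exact measure_lt_top _ _⟩
  refine shellWeightBound_histories_of_resamplingTower (On := On)
    (JA := fun K a k e => postLaw (μ K) (O K k) (F K k) (sel K k) (ΦA K a k) (insA K a k) (dA K a k) e)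
    (JpreA := fun K a k e => preLaw (μ K) (ΦA K a k) (dA K a k) e)
    (JB := fun K a k e => postLaw (μ K) (O K k) (F K k) (sel K k) (ΦB K a k) (insB K a k) (dB K a k) e)
    (JpreB := fun K a k e => preLaw (μ K) (ΦB K a k) (dB K a k) e)
    huA huB hsmall hsub hθ hκ hρ hwin hδ hΔ hgeom hdetA hdetB habsA habsB hpre hIT hsel
    hPA ?_ ?_ ?_ ?_ htiltA hdepTotA hPB ?_ ?_ ?_ ?_ htiltB hdepTotB hκmin hκminle hρhalf hϑ0 hϑ1 hrate
  -- run A (N): an older statistic reads no younger fibre, nor the younger coordinates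
  · intro K a _ c hc k hk _ s hs
    exact map_postLaw_eq_of_notRead (hinsAm K a k) (hdAm K a k) (hΦAm K a k) (hYO K k) (hYF K k) (hinsAY K a k) (hdAY K a k)
      (hΦA1 K a k) s (hdenA K a k s) (huA K c) (hpastA K c hc k hk s hs) (hyngA K c hc k hk.le)
  -- run A (Eoff)
  · intro K a _ c hc s hs hoff
    exact map_postLaw_eq_of_notRead (hinsAm K a _) (hdAm K a _) (hΦAm K a _) (hYO K _) (hYF K _) (hinsAY K a _) (hdAY K a _)
      (hΦA1 K a _) s (hdenA K a _ s) (huA K c) (fun h => hoffRA K c hc s hs h hoff) (hyngA K c hc _ le_rfl)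
  -- run A (Eon)
  · intro K a ha c hc s' hs'
    exact sum_map_postLaw_le (hinsAm K a _) (hdAm K a _) (hΦAm K a _) (hYO K _) (hYF K _) (hOF K _) (hinsAY K a _) (hdAY K a _)
      (hΦA1 K a _) (I K (lvl K c)) (On K (lvl K c) c) (hsel K _) (hfix K _) (hOnSent K _ c)
      (fun s hs hon => hquotA K a ha c hc s hs hon) (fun s hs hon => hdomA K a ha c hc s hs hon) (huA K c) (hcurA K c hc)
      (hyngA K c hc _ le_rfl) s' (hchargeA K a ha c hc s' hs')
  -- run A (Mass)
  · intro K a _ k _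
    rw [Measure.finsetSum_apply, Measure.finsetSum_apply]
    exact Finset.sum_congr rfl fun e _ => hmA K a k e
  -- run B (N)
  · intro K a _ c hc k hk _ s hs
    exact map_postLaw_eq_of_notRead (hinsBm K a k) (hdBm K a k) (hΦBm K a k) (hYO K k) (hYF K k) (hinsBY K a k) (hdBY K a k)
      (hΦB1 K a k) s (hdenB K a k s) (huB K c) (hpastB K c hc k hk s hs) (hyngB K c hc k hk.le)
  -- run B (Eoff)
  · intro K a _ c hc s hs hoff
    exact map_postLaw_eq_of_notRead (hinsBm K a _) (hdBm K a _) (hΦBm K a _) (hYO K _) (hYF K _) (hinsBY K a _) (hdBY K a _)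
      (hΦB1 K a _) s (hdenB K a _ s) (huB K c) (fun h => hoffRB K c hc s hs h hoff) (hyngB K c hc _ le_rfl)
  -- run B (Eon)
  · intro K a ha c hc s' hs'
    exact sum_map_postLaw_le (hinsBm K a _) (hdBm K a _) (hΦBm K a _) (hYO K _) (hYF K _) (hOF K _) (hinsBY K a _) (hdBY K a _)
      (hΦB1 K a _) (I K (lvl K c)) (On K (lvl K c) c) (hsel K _) (hfix K _) (hOnSent K _ c)
      (fun s hs hon => hquotB K a ha c hc s hs hon) (fun s hs hon => hdomB K a ha c hc s hs hon) (huB K c) (hcurB K c hc)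
      (hyngB K c hc _ le_rfl) s' (hchargeB K a ha c hc s' hs')
  -- run B (Mass)
  · intro K a _ k _
    rw [Measure.finsetSum_apply, Measure.finsetSum_apply]
    exact Finset.sum_congr rfl fun e _ => hmB K a k e

end Junction

/-! ## §4 A6 SATISFIABILITY WITNESS (director-ym STANDING A6 RULE, LINE №189 (3)): the binder set of `shellWeightBound_histories_of_liftedDensities`
is JOINTLY INHABITED — one coordinate, one term and one window slot per cutoff, unit densities and forward kernels, identity selector (no sent term, no
ON term), constant statistics, zero tilt; the END theorem is APPLIED to these data with every binder discharged in the kernel -/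

section Witness

/-- the toy stage laws (one-point coordinate space, Dirac reference law, unit density and kernel) are the product reference law itself. [folklore] -/
theorem toy_preLaw_eq (s : Unit) :
    preLaw (fun _ : Unit => (Measure.dirac () : Measure Unit)) (fun _ => (1 : ℝ≥0∞)) (fun _ _ => (1 : ℝ≥0∞)) s =
      Measure.pi fun _ : Unit => (Measure.dirac () : Measure Unit) := by
  simp only [preLaw, mul_one]
  exact withDensity_one

/-- … and so are the toy post-ℝ stage laws (identity selector: no sent term). [folklore] -/
theorem toy_postLaw_eq (s : Unit) :
    postLaw (fun _ : Unit => (Measure.dirac () : Measure Unit)) ∅ (fun _ => ∅) id (fun _ => (1 : ℝ≥0∞)) (fun _ _ => (1 : ℝ≥0∞))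
      (fun _ _ => (1 : ℝ≥0∞)) s =
      Measure.pi fun _ : Unit => (Measure.dirac () : Measure Unit) := by
  simp only [postLaw, liftDensity_of_eq (show id s = s from rfl), mul_one]
  exact withDensity_one

/-- **A6 WITNESS.**  The ~70 binders of `shellWeightBound_histories_of_liftedDensities` are simultaneously satisfiable: the theorem APPLIES to the toy
data (coordinates `𝔅 K = Unit`, `X K i = Unit`, Dirac reference law; terms and slots `Unit`; `T K = C K = I K k = small = smAll = nbhd = {()}`,
`lvl K c = K`, `pre = sel = id`, `On = ∅`; `O = Y = F = ∅`; densities, inserts, kernels `≡ 1`, quotients `q ≡ 0 ≡ B`; term laws `ν = Measure.pi`; statistics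
`≡ 0`; `θ ≡ 1`, `κ ≡ ½`, `ρ ≡ Δ ≡ 0`, `l₀ = B = δr = c₁ = 0`, `νbar = 1`, `N₁ = 0`, `κmin = ϑ = ½`), every hypothesis being proved, and returns an
admissible threshold selection.  (Degenerate by design: it certifies CONSISTENCY of the binder set, nothing about the record.) [folklore] -/
theorem liftedDensities_binders_inhabited :
    ∃ a : ℕ → ℕ → ℝ, ∀ K j, a K j ∈ Icc ((1 - (1 / 2 : ℝ)) * 1) 1 := by
  have hIcc_pos : ∀ {a : ℕ → ℝ}, (∀ j, a j ∈ Icc ((1 - (1 / 2 : ℝ)) * 1) 1) → ∀ j, 0 < a j := fun ha j => by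
    have := (ha j).1; linarith
  obtain ⟨a, ha, -⟩ := shellWeightBound_histories_of_liftedDensities
    (𝔅 := fun _ => Unit) (X := fun _ _ => Unit) (μ := fun _ _ => Measure.dirac ()) (σ := Unit) (ι := Unit)
    (T := fun _ => {()}) (C := fun _ => {()}) (small := fun _ _ => {()}) (smAll := fun _ _ => {()}) (nbhd := fun _ _ _ => {()})
    (lvl := fun K _ => K) (I := fun _ _ => {()}) (pre := fun _ _ => id) (sel := fun _ _ => id) (On := fun _ _ _ => ∅)
    (O := fun _ _ => ∅) (Y := fun _ _ => ∅) (F := fun _ _ _ => ∅)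
    (ΦA := fun _ _ _ _ => 1) (ΦB := fun _ _ _ _ => 1) (dA := fun _ _ _ _ _ => 1) (dB := fun _ _ _ _ _ => 1)
    (insA := fun _ _ _ _ _ => 1) (insB := fun _ _ _ _ _ => 1)
    (qA := fun _ _ _ _ => 0) (qB := fun _ _ _ _ => 0) (BA := fun _ _ _ _ => 0) (BB := fun _ _ _ _ => 0)
    (νA := fun _ _ _ _ => Measure.pi fun _ : Unit => (Measure.dirac () : Measure Unit))
    (νB := fun _ _ _ _ => Measure.pi fun _ : Unit => (Measure.dirac () : Measure Unit))
    (uA := fun _ _ _ => 0) (uB := fun _ _ _ => 0) (θ := fun _ => 1) (κ := fun _ => 1 / 2) (ρ := fun _ => 0) (Δ := fun _ => 0)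
    (l₀ := 0) (νbar := 1) (δr := 0) (B := 0) (N₁ := 0) (κmin := 1 / 2) (c₁ := 0) (ϑ := 1 / 2)
    (fun _ _ => measurable_const) (fun _ _ => measurable_const)
    (fun _ _ _ => Finset.Subset.rfl) (fun _ _ _ => Finset.Subset.rfl)
    (fun _ => one_pos) (fun _ => ⟨by norm_num, by norm_num⟩) (fun _ => ⟨le_rfl, one_pos⟩)
    ⟨fun K _ _ => by omega, fun K _ _ => le_rfl, fun K j => by
      norm_num only [Nat.cast_le_one]
      exact (Finset.card_filter_le _ _).trans (by simp)⟩
    le_rfl (fun _ => by simp) (fun _ _ _ _ _ => Finset.Subset.rfl)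
    (fun _ _ _ _ _ _ _ => by simp) (fun _ _ _ _ _ _ _ => by simp)
    (fun K a ha _ _ _ _ => Filter.Eventually.of_forall fun _ _ _ => hIcc_pos ha K)
    (fun K a ha _ _ _ _ => Filter.Eventually.of_forall fun _ _ _ => hIcc_pos ha K)
    (fun _ _ _ _ h => h) (fun _ => rfl) (fun _ _ _ h => h) (fun _ _ _ _ => rfl) (fun _ _ _ _ h => (Finset.notMem_empty _ h).elim)
    (fun _ _ _ => disjoint_bot_left) (fun _ _ => disjoint_bot_left) (fun _ _ _ => disjoint_bot_left)
    -- run A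
    (fun _ _ _ _ => measurable_const) (fun _ _ _ _ => measurable_const) (fun _ _ _ => measurable_const)
    (fun _ _ _ _ _ _ => rfl) (fun _ _ _ _ _ _ => rfl) (fun _ _ _ => lmarginal_empty _ _) (fun _ _ _ _ => by simp)
    (fun _ _ _ _ h => (h rfl).elim)
    (fun _ _ _ _ _ _ _ _ _ _ => rfl) (fun _ _ _ _ _ _ _ _ _ => rfl) (fun _ _ _ _ _ => rfl) (fun _ _ _ _ _ _ _ => rfl)
    (fun _ _ _ _ _ _ _ h => (Finset.notMem_empty _ h).elim) (fun _ _ _ _ _ _ _ h => (Finset.notMem_empty _ h).elim)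
    (fun _ _ _ _ _ _ _ => by simp)
    (fun K a _ k _ s _ => by
      rw [Finset.filter_true_of_mem fun e _ => rfl, Finset.sum_singleton, toy_preLaw_eq, toy_postLaw_eq])
    (fun K a _ t _ τ _ => by
      rw [toy_postLaw_eq, mul_zero, Real.exp_zero, ENNReal.ofReal_one, one_smul]; exact ⟨le_rfl, le_rfl⟩)
    (fun _ _ _ _ _ => rfl)
    -- run B
    (fun _ _ _ _ => measurable_const) (fun _ _ _ _ => measurable_const) (fun _ _ _ => measurable_const)
    (fun _ _ _ _ _ _ => rfl) (fun _ _ _ _ _ _ => rfl) (fun _ _ _ => lmarginal_empty _ _) (fun _ _ _ _ => by simp)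
    (fun _ _ _ _ h => (h rfl).elim)
    (fun _ _ _ _ _ _ _ _ _ _ => rfl) (fun _ _ _ _ _ _ _ _ _ => rfl) (fun _ _ _ _ _ => rfl) (fun _ _ _ _ _ _ _ => rfl)
    (fun _ _ _ _ _ _ _ h => (Finset.notMem_empty _ h).elim) (fun _ _ _ _ _ _ _ h => (Finset.notMem_empty _ h).elim)
    (fun _ _ _ _ _ _ _ => by simp)
    (fun K a _ k _ s _ => by
      rw [Finset.filter_true_of_mem fun e _ => rfl, Finset.sum_singleton, toy_preLaw_eq, toy_postLaw_eq])
    (fun K a _ t _ τ _ => by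
      rw [toy_postLaw_eq, mul_zero, Real.exp_zero, ENNReal.ofReal_one, one_smul]; exact ⟨le_rfl, le_rfl⟩)
    (fun _ _ _ _ _ => rfl)
    (by norm_num) (fun _ => le_rfl) (fun _ => by norm_num) (by norm_num) (by norm_num) (fun _ => by simp)
  exact ⟨a, ha⟩

end Witness

end Summit.QuantumFields.YangMills.Theorems.N21HistoriesHybridLiftTower
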